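import Mathlib
import HarnessLib
import Literature.Probability.MarkovChains.IsingCycleEigenfunction
import Literature.Probability.MarkovChains.WilsonMethod
import Literature.Probability.MarkovChains.ConvergenceTheorem

/-!
# Wilson's method applied to the magnetisation on the cycle: the lower bound of (15.16) (Levin–Peres–Wilmer Theorem 15.5)

HONEST FRAMING: exact (Metropolis-corrected) sampling algorithms for lattice gauge theory; figures
of merit are autocorrelation/cost numbers at stated couplings and volumes; no continuum-physics claim.

Conventions of `IsingCycleEigenfunction.lean` (`magnetisation = Φ`, eq. (15.17)), `WilsonMethod.lean`
(Theorem 13.28 `LevinPeres2017_thm_13_28`), `ConvergenceTheorem.lean` (Theorem 4.9, `IsAperiodic`,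
`isAperiodic_of_diag_pos`), `IsingGlauber.lean` / `GlauberDynamics.lean`.  Source: D. A. Levin,
Y. Peres (with E. L. Wilmer), *Markov Chains and Mixing Times*, 2nd ed., AMS 2017 [LevinPeres2017],
§15.3 proof of Theorem 15.5, last paragraph (p. 220), with §13.5 Theorem 13.28.  Everything is
PROVED (0 named facts).

* `glauber_eigen_pointwise` — the eigen-equation (15.17) in the pointwise form `Σ_τ P(σ,τ)Φ(τ) = λΦ(σ)`
  used by Theorem 13.28;
* `magnetisation_update`, `glauber_sq_increment_le_four` — "if `σ̃` is the state obtained after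
  updating `σ` according to the Glauber dynamics, then `|Φ(σ̃) − Φ(σ)| ≤ 2`", hence
  `Σ_τ P(σ,τ)(Φ(τ) − Φ(σ))² ≤ R = 4` [cite: LevinPeres2017, §15.3 proof of Thm 15.5 (last
  paragraph)];
* `isingGlauber_exists_worstTvDist_le` — the Glauber dynamics is irreducible and aperiodic, so `d(t) ≤ ε`
  for some `t` (Theorem 4.9; the standing hypothesis of Theorem 13.28's mixing-time form);
* **`LevinPeres2017_thm_15_5_tmix_lower`** — taking `x` = the all-plus configuration (`Φ(x) = n`) in
  (13.28): for `β ≥ 0`, `0 < ε < 1`, with `λ = 1 − c_O(β)/n`, `c_O(β) = 1 − tanh(2β)`,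
  **`t_mix(ε) ≥ [2 log(1/λ)]⁻¹ · (log(c_O(β)·n/8) + log((1−ε)/ε))`** — the display that the book then
  reads as `[1 + o(1)] n log n/(2c_O(β))`, i.e. the left inequality of (15.16)
  [cite: LevinPeres2017, §15.3 Thm 15.5 eq. (15.16) (lower bound) and its proof via (13.28)].

SCOPE: `n ≥ 3` (Mathlib's `cycleGraph (n+3)`), `β ≥ 0` (so that `λ > 1/2`, as Theorem 13.28 requires);
the asymptotic reading `[1 + o(1)] n log n/(2c_O)` is not a formal statement and is not asserted.
-/

namespace Literature.Probability.MarkovChains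

open Finset Function Fin.CommRing
open scoped Matrix

variable {n : ℕ}

/-- The eigen-equation (15.17) pointwise: `Σ_τ P(σ,τ)Φ(τ) = λΦ(σ)`, `λ = 1 − (1 − tanh 2β)/n`.
[cite: LevinPeres2017, §15.3 proof of Thm 15.5, eq. (15.17)] -/
theorem glauber_eigen_pointwise (β : ℝ) (σ : Fin (n + 3) → ℤˣ) :
    ∑ τ, glauberKernel (gibbsLaw (SimpleGraph.cycleGraph (n + 3)) β) σ τ * magnetisation τ =
      (1 - (1 - Real.tanh (2 * β)) / (n + 3 : ℝ)) * magnetisation σ := by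
  have h := congrFun (LevinPeres2017_eq_15_17 (n := n) β) σ
  rw [Pi.smul_apply, smul_eq_mul] at h
  rw [← h]
  rfl

/-- `Φ(σ^{w←s}) = Φ(σ) − σ(w) + s`. [cite: LevinPeres2017, §15.3 proof of Thm 15.5 ("`|Φ(σ̃) − Φ(σ)| ≤
2`")] -/
theorem magnetisation_update {V : Type*} [Fintype V] [DecidableEq V] (σ : V → ℤˣ) (w : V) (s : ℤˣ) :
    magnetisation (update σ w s) = magnetisation σ - ((σ w : ℤ) : ℝ) + ((s : ℤ) : ℝ) := by
  unfold magnetisation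
  rw [← sum_erase_add _ _ (mem_univ w), ← sum_erase_add univ (fun i => ((σ i : ℤ) : ℝ)) (mem_univ w),
    update_self, sum_congr rfl fun i hi => by rw [update_of_ne (ne_of_mem_erase hi)]]
  ring

/-- **`Σ_τ P(σ,τ)(Φ(τ) − Φ(σ))² ≤ 4`**: one Glauber update changes the magnetisation by `0` or `±2`.
[cite: LevinPeres2017, §15.3 proof of Thm 15.5 ("if `σ̃` is the state obtained after updating `σ` …
then `|Φ(σ̃) − Φ(σ)| ≤ 2`"; `R` of Thm 13.28)] -/
theorem glauber_sq_increment_le_four {V : Type*} [Fintype V] [DecidableEq V] [Nonempty V]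
    {G : SimpleGraph V} [DecidableRel G.Adj] (β : ℝ) (σ : V → ℤˣ) :
    ∑ τ, glauberKernel (gibbsLaw G β) σ τ * (magnetisation τ - magnetisation σ) ^ 2 ≤ 4 := by
  have h := glauber_mulVec_apply (G := G) β (fun τ => (magnetisation τ - magnetisation σ) ^ 2) σ
  simp only [Matrix.mulVec, dotProduct] at h
  rw [h]
  have hp0 : ∀ w s, 0 ≤ glauberSiteLaw (gibbsLaw G β) σ w (update σ w s) :=
    fun w s => glauberSiteLaw_nonneg (fun x => (gibbsLaw_pos (G := G) β x).le) σ w _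
  have hsq : ∀ w (s : ℤˣ), (magnetisation (update σ w s) - magnetisation σ) ^ 2 ≤ 4 := by
    intro w s
    rw [magnetisation_update, show magnetisation σ - ((σ w : ℤ) : ℝ) + ((s : ℤ) : ℝ) - magnetisation σ =
      ((s : ℤ) : ℝ) - ((σ w : ℤ) : ℝ) by ring]
    rcases Int.units_eq_one_or s with rfl | rfl <;> rcases Int.units_eq_one_or (σ w) with h | h <;>
      rw [h] <;> norm_num
  have hsum1 : ∀ w, ∑ s : ℤˣ, glauberSiteLaw (gibbsLaw G β) σ w (update σ w s) = 1 := by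
    intro w
    have := (siteLaw_plus_minus (G := G) β σ w).1
    rw [sum_units_int]; exact this
  have hn : (0 : ℝ) < Fintype.card V := by exact_mod_cast Fintype.card_pos
  calc (Fintype.card V : ℝ)⁻¹ * ∑ w, ∑ s : ℤˣ, glauberSiteLaw (gibbsLaw G β) σ w (update σ w s) *
          (magnetisation (update σ w s) - magnetisation σ) ^ 2
      ≤ (Fintype.card V : ℝ)⁻¹ * ∑ w, ∑ s : ℤˣ, glauberSiteLaw (gibbsLaw G β) σ w (update σ w s) * 4 := by
        refine mul_le_mul_of_nonneg_left (sum_le_sum fun w _ => sum_le_sum fun s _ => ?_)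
          (inv_nonneg.2 hn.le)
        exact mul_le_mul_of_nonneg_left (hsq w s) (hp0 w s)
    _ = 4 := by
        have e : ∀ w, ∑ s : ℤˣ, glauberSiteLaw (gibbsLaw G β) σ w (update σ w s) * 4 = 4 := fun w => by
          rw [← sum_mul, hsum1 w, one_mul]
        rw [sum_congr rfl fun w _ => e w, sum_const, card_univ, nsmul_eq_mul, ← mul_assoc,
          inv_mul_cancel₀ hn.ne', one_mul]

/-- The Ising Glauber dynamics mixes: `d(t) ≤ ε` for some `t` (irreducible, aperiodic since
`P(σ,σ) > 0`; Theorem 4.9). [cite: LevinPeres2017, §4.3 Thm 4.9 with §3.3.5 (the Glauber dynamics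
for `μ`)] -/
theorem isingGlauber_exists_worstTvDist_le {V : Type*} [Fintype V] [DecidableEq V] [Nonempty V]
    (G : SimpleGraph V) [DecidableRel G.Adj] (β : ℝ) {ε : ℝ} (hε : 0 < ε) :
    ∃ t, worstTvDist (glauberKernel (gibbsLaw G β)) (gibbsLaw G β) t ≤ ε := by
  have hπ := gibbsLaw_pos (G := G) β
  obtain ⟨α, C, hα0, hα1, hC, hbound⟩ := LevinPeres2017_thm_4_9 (glauberKernel_isRowStochastic hπ)
    (isingGlauber_isIrreducible β) (isAperiodic_of_diag_pos fun x => glauberKernel_diag_pos hπ x)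
    (isingGlauber_isStationary β) (fun x => (hπ x).le) (sum_gibbsLaw β)
  obtain ⟨t, ht⟩ := exists_pow_lt_of_lt_one (div_pos hε hC) hα1
  refine ⟨t, (hbound t).trans ?_⟩
  rw [lt_div_iff₀ hC] at ht
  linarith [mul_comm C (α ^ t)]

/-- **THEOREM 15.5, lower bound of (15.16) via Wilson's method (13.28).** For the Ising Glauber dynamics
on the `n`-cycle (`n ≥ 3`), `β ≥ 0`, `0 < ε < 1`, with `c_O(β) = 1 − tanh(2β)` and
`λ = 1 − c_O(β)/n` (the eigenvalue (15.17) of the magnetisation, `R = 4`, `x` = all-plus so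
`Φ(x) = n`): **`t_mix(ε) ≥ [2 log(1/λ)]⁻¹ · (log((1−λ)n²/8) + log((1−ε)/ε))`**, the display the book
reads as `[1 + o(1)] n log n/(2c_O(β))`. [cite: LevinPeres2017, §15.3 Thm 15.5 eq. (15.16) (left
inequality), proof ("taking `x` to be the all-plus configuration, (13.28) yields …")] -/
theorem LevinPeres2017_thm_15_5_tmix_lower {β : ℝ} (hβ : 0 ≤ β) {ε : ℝ} (hε : 0 < ε) (hε1 : ε < 1) :
    1 / (2 * Real.log (1 / (1 - (1 - Real.tanh (2 * β)) / (n + 3 : ℝ)))) *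
        (Real.log ((1 - (1 - (1 - Real.tanh (2 * β)) / (n + 3 : ℝ))) * (n + 3 : ℝ) ^ 2 / (2 * 4)) +
          Real.log ((1 - ε) / ε)) ≤
      (mixingTime (glauberKernel (gibbsLaw (SimpleGraph.cycleGraph (n + 3)) β))
        (gibbsLaw (SimpleGraph.cycleGraph (n + 3)) β) ε : ℝ) := by
  set G := SimpleGraph.cycleGraph (n + 3)
  set lam : ℝ := 1 - (1 - Real.tanh (2 * β)) / (n + 3 : ℝ) with hlam
  have hπ := gibbsLaw_pos (G := G) β
  -- `1/2 < λ < 1`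
  have ht1 : Real.tanh (2 * β) < 1 := Real.tanh_lt_one _
  have ht0 : 0 ≤ Real.tanh (2 * β) := by
    rw [Real.tanh_eq_sinh_div_cosh]
    exact div_nonneg (Real.sinh_nonneg_iff.2 (by linarith)) (Real.cosh_pos _).le
  have hN : (3 : ℝ) ≤ (n + 3 : ℝ) := by
    have : (0 : ℝ) ≤ n := Nat.cast_nonneg n
    linarith
  have hlam1 : lam < 1 := by
    rw [hlam]
    have : 0 < (1 - Real.tanh (2 * β)) / (n + 3 : ℝ) := div_pos (by linarith) (by linarith)
    linarith
  have hlam2 : 1 / 2 < lam := by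
    rw [hlam]
    have : (1 - Real.tanh (2 * β)) / (n + 3 : ℝ) ≤ 1 / 3 := by
      rw [div_le_div_iff₀ (by linarith) (by norm_num)]
      nlinarith
    linarith
  -- the all-plus configuration
  have hx : magnetisation (fun _ : Fin (n + 3) => (1 : ℤˣ)) ≠ 0 := by
    unfold magnetisation
    simp only [Units.val_one, Int.cast_one, sum_const, card_univ, Fintype.card_fin, nsmul_eq_mul,
      mul_one]
    positivity
  have hΦx : magnetisation (fun _ : Fin (n + 3) => (1 : ℤˣ)) = (n + 3 : ℝ) := by
    unfold magnetisation
    simp only [Units.val_one, Int.cast_one, sum_const, card_univ, Fintype.card_fin, nsmul_eq_mul,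
      mul_one]
    push_cast
    ring
  have h := LevinPeres2017_thm_13_28 (glauberKernel_isRowStochastic hπ) (fun x => (hπ x).le)
    (sum_gibbsLaw β) (isingGlauber_isStationary β) (Φ := magnetisation) (lam := lam)
    (fun σ => glauber_eigen_pointwise (n := n) β σ) hlam2 hlam1 (R := 4) (by norm_num)
    (fun σ => glauber_sq_increment_le_four (G := G) β σ) hε hε1 hx
    (isingGlauber_exists_worstTvDist_le G β hε)
  rw [hΦx] at h
  exact h

end Literature.Probability.MarkovChains
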